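import Summits.Ventures.CertifiedManyBodySolver.Theorems.M3x2EdgeSplitSymReplayOutRoute
import HarnessLib

/-!
# SymReplay gramR — OUTROUTE (T20b): executed refinements, the fast-skeleton spec, kernel demos

On top of `…OutRoute` (soundness of partial-free sharding by an output key; every name there):
(e) kernel demos on `toyRCert` (`J = 1` any key; `J = 3` fine key, frame-list canon; `J = 3` coarse key, box canon; share
sizes; the non-example of a length key: sound, not complete);
(f) PUSHED BASE FILTER `baseShareF` / `shareRWith` / `shareRF` — nothing of the base residual is built whole, the generated
bases are supplied once per module — with `shareRF_eq : shareRF K (K.gramR.map genBasis) κ J i = shareR K κ J i`;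
(g) BUCKETED modules `outOKVL` / `outOKBL K κ J L [lo hi] i`: module `i` of `J` checks the `L` fine slots `L·i, …, L·i+L−1`
of the `J·L`-slot partition one after the other (peak memory ≈ one fine slot, one `genBasis` pass per module), `OutFactsL` /
`OutFactsBL`, `wardD4CertGe_of_outrouteL`, `energyDensity_ge_of_outrouteBL`;
(h) the SPEC for a fast skeleton: for ANY executed share function `S : ℕ → QPoly` with `∀ i < J, (S i).Perm (shareR K κ J i)`
the `J` facts `isZero (canonNFZ[V|B] … (S i))` close (`OutFactsS[B]`, `wardD4CertGe_of_outrouteS`,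
`energyDensity_ge_of_outrouteSB`) — an engine's allocation-free `shareRFast` owes exactly that permutation lemma for ITS key;
(i) toys: the bucketed form end to end (`J = 1`, `L = 3`, box canon) and the spec theorem instantiated with `S := shareRF …`.

CLOSING GRAMMAR (bucketed, box canon; literals `J L lo hi`): per module
`out_i : outOKBL K pairKey J L lo hi i = true := by native_decide` (`i < J`), then
`energyDensity_ge_of_outrouteBL K hwf hRok pairKey J L hJ hL lo hi hbox ⟨out_0, …, out_{J-1}, trivial⟩`.

HONEST FRAMING: checker plumbing; no certificate is replayed here; no bound of record moves; no summit or crux statement is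
proved; nothing here predicts superconductivity.
-/

noncomputable section

namespace Summit.Ventures.CertifiedManyBodySolver.Theorems.SymReplay

open Matrix Finset
open Literature.MathematicalPhysics.QuantumLattice
open Literature.MathematicalPhysics.QuantumLattice.HubbardWave0
open Literature.MathematicalPhysics.QuantumLattice.ThermodynamicLimit
open Literature.Probability.LatticeModels
open Literature.MathematicalPhysics.QuantumManyBody.StateRelaxation
open Summit.Ventures.CertifiedManyBodySolver.Theorems.WardSlot
open scoped ComplexOrder BigOperators

/-! ##### (e) Kernel demos on `toyRCert` -/

/-- `J = 1`: the single share is the whole raw residual (any key): the one-call local R-check in OUTROUTE clothing. -/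
example : ((symValueR toyRCert : ℚ) : ℝ) ≤ energyDensityTT' 1 0 8 (7 / 8) :=
  energyDensity_ge_of_outroute toyRCert (by decide +kernel)
    (gramR_all_of_facts toyRCert 2 (by decide +kernel) ⟨by decide +kernel, by decide +kernel, trivial⟩) lenKey 1 (by decide)
    ⟨by decide +kernel, trivial⟩

/-- `J = 3` with the fine key: three modules, no partials. -/
example : ((symValueR toyRCert : ℚ) : ℝ) ≤ energyDensityTT' 1 0 8 (7 / 8) :=
  energyDensity_ge_of_outroute toyRCert (by decide +kernel)
    (gramR_all_of_facts toyRCert 2 (by decide +kernel) ⟨by decide +kernel, by decide +kernel, trivial⟩) pairKey 3 (by decide)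
    ⟨by decide +kernel, by decide +kernel, by decide +kernel, trivial⟩

/-- `J = 3` with the coarse key and the BOX canon. -/
example : ((symValueR toyRCert : ℚ) : ℝ) ≤ energyDensityTT' 1 0 8 (7 / 8) :=
  energyDensity_ge_of_outrouteB toyRCert (by decide +kernel)
    (gramR_all_of_factsB toyRCert (minCornerP frame3) (maxCornerP frame3) (by decide +kernel) 2 (by decide +kernel)
      ⟨by decide +kernel, by decide +kernel, trivial⟩)
    netKey 3 (by decide) (minCornerP frame3) (maxCornerP frame3) (by decide +kernel)
    ⟨by decide +kernel, by decide +kernel, by decide +kernel, trivial⟩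

/-- Non-vacuity and the completeness caveat, on the toy (74 raw terms): the fine key splits them 36 / 28 / 10 and the coarse key
46 / 28 / 0, every share cancelling alone; the length key splits 2 / 2 / 70 and its modules 0 and 2 FAIL although the whole
residual cancels (normal ordering moves a contraction's constant out of its raw term's length class) — soundness is untouched,
completeness is the key's job. -/
example : (sharesR toyRCert pairKey 3).map List.length = [36, 28, 10] ∧
    (List.range 3).map (outOKV toyRCert pairKey 3) = [true, true, true] ∧
    (sharesR toyRCert netKey 3).map List.length = [46, 28, 0] ∧
    (sharesR toyRCert lenKey 3).map List.length = [2, 2, 70] ∧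
    (List.range 3).map (outOKV toyRCert lenKey 3) = [false, true, false] := by
  decide +kernel

/-! ##### (f) PUSHED BASE FILTER: nothing of the base residual is built whole

`baseShareF K♭ P` is `(baseShardL K♭).filter P` with the filter pushed into every summand of `LHS −ₗ rhsNonBlockL`
(a commutator `[A, B]ₗ` contributes `(A·B)|P ++ (−1)·(B·A)|P`); `shareRF` = `shareR` with that base (list equality, so every
rev-1 theorem applies verbatim through `shareRF_eq`). -/

/-- The base share with the slot filter pushed to the summands. -/
def baseShareF (K : SymCert) (P : ℚ × Word → Bool) : QPoly :=
  (lhsPoly K).filter P ++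
  pscale (-1)
    ((K.gram.flatMap fun g => pscale g.1 ((pmul (padj g.2) g.2).filter P)) ++
      (K.eom.flatMap fun B =>
        (pmul (hamPoly (localFrame B)) B).filter P ++ pscale (-1) ((pmul B (hamPoly (localFrame B))).filter P)) ++
      (K.moves.flatMap fun mv => [(mv.z, moveWord mv.γ mv.v mv.u), (-mv.z, mv.u)].filter P) ++
      K.charged.filter P ++
      (K.wardP.flatMap fun X =>
        (pmul (spinPlusPoly (sitesOf X)) X).filter P ++ pscale (-1) ((pmul X (spinPlusPoly (sitesOf X))).filter P)) ++
      (K.wardM.flatMap fun X =>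
        (pmul (spinMinusPoly (sitesOf X)) X).filter P ++ pscale (-1) ((pmul X (spinMinusPoly (sitesOf X))).filter P)) ++
      (K.antiH.flatMap fun t => pscale t.1 ((padj t.2).filter P ++ pscale (-1) (t.2.filter P))) ++
      K.slack.filter P)

/-- The pushed base share IS the filtered base shard (list equality). -/
theorem baseShareF_eq (K : SymCert) (Pw : Word → Bool) :
    baseShareF K (wordPred Pw) = (baseShardL K).filter (wordPred Pw) := by
  simp only [baseShareF, baseShardL, rhsNonBlockL, psub, comm, List.filter_append, List.filter_flatMap, filter_pscale,
    pscale_append, pscale_flatMap, pscale_pscale, List.append_assoc]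

/-- The R-part of a share with the generated bases SUPPLIED (`gbs`, one list per R-block, in block order) — so that a module
checking several fine slots generates the bases once. -/
def shareRWith (K : SymCertR) (gbs : List (List QPoly)) (P : ℚ × Word → Bool) : QPoly :=
  (K.gramR.zip gbs).flatMap fun Bg =>
    let qr := Bg.2.zip Bg.1.rows
    let m : ℚ := (Bg.1.moves.length : ℚ)
    (Bg.1.reps.zip Bg.1.rows).flatMap fun a =>
      let ua := padj a.1
      qr.flatMap fun b =>
        let g := sdot a.2 b.2
        if g = 0 then [] else pscale (-1 * (m * (Bg.1.scale * g))) ((pmul ua b.1).filter P)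

/-- `flatMap` over `l.zip (l.map f)` is a `flatMap` over `l`. -/
theorem flatMap_zip_map_self {α β γ : Type} (f : α → β) (F : α × β → List γ) :
    ∀ l : List α, (l.zip (l.map f)).flatMap F = l.flatMap fun a => F (a, f a)
  | [] => rfl
  | a :: l => by rw [List.map_cons, List.zip_cons_cons, List.flatMap_cons, List.flatMap_cons, flatMap_zip_map_self f F l]

/-- **Executed share**: pushed base filter + supplied bases.  With `gbs = K.gramR.map genBasis` it IS `shareR`. -/
def shareRF (K : SymCertR) (gbs : List (List QPoly)) (κ : Word → ℕ) (J i : ℕ) : QPoly :=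
  let P := wordPred (inSlotW κ J i)
  baseShareF K.toSymCert P ++
  (pscale (-1) (K.gramM.flatMap fun B => (gramBlockPoly B).filter P) ++
  shareRWith K gbs P)

/-- **The executed share with the generated bases passed in equals `shareR`** (so its facts are `shareR`'s facts). -/
theorem shareRF_eq (K : SymCertR) (κ : Word → ℕ) (J i : ℕ) :
    shareRF K (K.gramR.map genBasis) κ J i = shareR K κ J i := by
  simp only [shareRF, shareR, shareRWith, baseShareF_eq, flatMap_zip_map_self, filter_pscale, List.filter_flatMap]

/-! ##### (g) BUCKETED MODULES: module `i` of `J` checks the `L` fine slots `L·i, …, L·i+L−1` of the `J·L`-slot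
partition one after the other (bases generated ONCE per module; peak memory ≈ one fine slot's pipe; wall ≈ L skeleton passes
+ 1/J of the nf/collect/canon total).  Same soundness theorem, reached through `OutFacts K κ (J·L)`. -/

/-- Module `i`'s bucketed check (V canon). -/
def outOKVL (K : SymCertR) (κ : Word → ℕ) (J L i : ℕ) : Bool :=
  let gbs := K.gramR.map genBasis
  (List.range L).all fun i' => isZero (canonNFZV K.frame (shareRF K gbs κ (J * L) (L * i + i')))

/-- Module `i`'s bucketed check (box canon — the one to run). -/
def outOKBL (K : SymCertR) (κ : Word → ℕ) (J L : ℕ) (lo hi : ℤ × ℤ) (i : ℕ) : Bool :=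
  let gbs := K.gramR.map genBasis
  (List.range L).all fun i' => isZero (canonNFZB lo hi (shareRF K gbs κ (J * L) (L * i + i')))

/-- Under the licence the bucketed box fact IS the bucketed frame-list fact. -/
theorem outOKBL_eq (K : SymCertR) (κ : Word → ℕ) (J L : ℕ) {lo hi : ℤ × ℤ} (h : boxLicence K.frame lo hi = true) (i : ℕ) :
    outOKBL K κ J L lo hi i = outOKVL K κ J L i := by
  simp only [outOKBL, outOKVL, canonNFZB_eq h]

/-- A bucketed fact gives the fine-slot fact of each of its `L` slots. -/
theorem outOKV_of_outOKVL (K : SymCertR) (κ : Word → ℕ) {J L i : ℕ} (h : outOKVL K κ J L i = true) {i' : ℕ} (hi' : i' < L) :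
    outOKV K κ (J * L) (L * i + i') = true := by
  simp only [outOKVL, List.all_eq_true, List.mem_range] at h
  rw [outOKV, ← shareRF_eq]
  exact h i' hi'

/-- The bucketed per-module facts for modules `i, …, i+n−1`. -/
def OutFactsL (K : SymCertR) (κ : Word → ℕ) (J L : ℕ) : ℕ → ℕ → Prop
  | _, 0 => True
  | i, n + 1 => outOKVL K κ J L i = true ∧ OutFactsL K κ J L (i + 1) n

/-- Bucketed box facts for modules `i, …, i+n−1` (structural on `n`). -/
def OutFactsBL (K : SymCertR) (κ : Word → ℕ) (J L : ℕ) (lo hi : ℤ × ℤ) : ℕ → ℕ → Prop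
  | _, 0 => True
  | i, n + 1 => outOKBL K κ J L lo hi i = true ∧ OutFactsBL K κ J L lo hi (i + 1) n

/-- Bucketed box facts give bucketed frame-list facts (structural). -/
theorem outFactsL_of_BL (K : SymCertR) (κ : Word → ℕ) (J L : ℕ) {lo hi : ℤ × ℤ} (h : boxLicence K.frame lo hi = true) :
    ∀ (n i : ℕ), OutFactsBL K κ J L lo hi i n → OutFactsL K κ J L i n := by
  intro n
  induction n with
  | zero => intro i _; exact trivial
  | succ n ih => intro i hf; exact ⟨(outOKBL_eq K κ J L h i).symm.trans hf.1, ih (i + 1) hf.2⟩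

/-- Fine-slot facts for a range, from a pointwise hypothesis. -/
theorem outFacts_of_forall (K : SymCertR) (κ : Word → ℕ) (N : ℕ) :
    ∀ (n a : ℕ), (∀ k, k < n → outOKV K κ N (a + k) = true) → OutFacts K κ N a n := by
  intro n
  induction n with
  | zero => intro a _; exact trivial
  | succ n ih =>
    intro a h
    refine ⟨by simpa using h 0 (Nat.succ_pos n), ih (a + 1) fun k hk => ?_⟩
    have := h (k + 1) (by omega)
    rwa [show a + (k + 1) = a + 1 + k by omega] at this

/-- Fine-slot facts of two adjacent ranges concatenate. -/
theorem outFacts_append (K : SymCertR) (κ : Word → ℕ) (N : ℕ) :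
    ∀ (m a n : ℕ), OutFacts K κ N a m → OutFacts K κ N (a + m) n → OutFacts K κ N a (m + n) := by
  intro m
  induction m with
  | zero => intro a n _ h; simpa using h
  | succ m ih =>
    intro a n h1 h2
    rw [show m + 1 + n = (m + n) + 1 by omega]
    exact ⟨h1.1, ih (a + 1) n h1.2 (by rwa [show a + 1 + m = a + (m + 1) by omega])⟩

/-- Bucketed module facts give the fine-slot facts. -/
theorem outFacts_of_L (K : SymCertR) (κ : Word → ℕ) (J L : ℕ) :
    ∀ (n i : ℕ), OutFactsL K κ J L i n → OutFacts K κ (J * L) (L * i) (L * n) := by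
  intro n
  induction n with
  | zero => intro i _; rw [Nat.mul_zero]; exact trivial
  | succ n ih =>
    intro i h
    rw [Nat.mul_succ, Nat.add_comm (L * n) L]
    refine outFacts_append K κ (J * L) L (L * i) (L * n) ?_ ?_
    · exact outFacts_of_forall K κ (J * L) L (L * i) fun k hk => outOKV_of_outOKVL K κ h.1 hk
    · rw [← Nat.mul_succ]; exact ih (i + 1) h.2

/-- **BUCKETED OUTROUTE IS SOUND.** -/
theorem wardD4CertGe_of_outrouteL (K : SymCertR) (hwf : wellFormed K.expand = true)
    (hRok : K.gramR.all (gramBlockROK K.frame) = true) (κ : Word → ℕ) (J L : ℕ) (hJ : 0 < J) (hL : 0 < L)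
    (hfacts : OutFactsL K κ J L 0 J) : WardD4CertGe ((symValueR K : ℚ) : ℝ) := by
  refine wardD4CertGe_of_outroute K hwf hRok κ (J * L) (Nat.mul_pos hJ hL) ?_
  have h := outFacts_of_L K κ J L J 0 hfacts
  rwa [Nat.mul_zero, Nat.mul_comm L J] at h

/-- **Bucketed closing theorem (box canon).**  CLOSING GRAMMAR: per module `i < J` one file
`theorem out_i : outOKBL K κ J L lo hi i = true := by native_decide`; `hfacts := ⟨out_0, …, out_{J−1}, trivial⟩`. -/
theorem energyDensity_ge_of_outrouteBL (K : SymCertR) (hwf : wellFormed K.expand = true)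
    (hRok : K.gramR.all (gramBlockROK K.frame) = true) (κ : Word → ℕ) (J L : ℕ) (hJ : 0 < J) (hL : 0 < L)
    (lo hi : ℤ × ℤ) (hbox : boxLicence K.frame lo hi = true) (hfacts : OutFactsBL K κ J L lo hi 0 J) :
    ((symValueR K : ℚ) : ℝ) ≤ energyDensityTT' 1 0 8 (7 / 8) :=
  energyDensity_ge_of_windowSound_cert _ WardSlot.stub_wardWindowSound
    (wardD4CertGe_of_outrouteL K hwf hRok κ J L hJ hL (outFactsL_of_BL K κ J L hbox J 0 hfacts))

/-! ##### (h) SPEC FOR A FAST SKELETON: any executed share function `S` that is, module by module, a PERMUTATION of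
`shareR K κ J i` closes through the same chain (the engine proves `hS` once for its loop; order of emission is free). -/

/-- `polyOp` is invariant under permutation of the term list. -/
theorem polyOp_perm (Λ' : Finset (Site 2)) {p q : QPoly} (h : p.Perm q) : polyOp Λ' p = polyOp Λ' q := by
  rw [polyOp_eq_evalP, polyOp_eq_evalP]; exact evalP_perm _ h

/-- Per-module facts for an arbitrary executed share function `S` (V canon / box canon). -/
def OutFactsS (K : SymCertR) (S : ℕ → QPoly) : ℕ → ℕ → Prop
  | _, 0 => True
  | i, n + 1 => isZero (canonNFZV K.frame (S i)) = true ∧ OutFactsS K S (i + 1) n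

/-- Box facts of an arbitrary share function `S` for modules `i, …, i+n−1` (structural on `n`). -/
def OutFactsSB (K : SymCertR) (S : ℕ → QPoly) (lo hi : ℤ × ℤ) : ℕ → ℕ → Prop
  | _, 0 => True
  | i, n + 1 => isZero (canonNFZB lo hi (S i)) = true ∧ OutFactsSB K S lo hi (i + 1) n

/-- Box `S`-facts give frame-list `S`-facts (structural). -/
theorem outFactsS_of_B (K : SymCertR) (S : ℕ → QPoly) {lo hi : ℤ × ℤ} (h : boxLicence K.frame lo hi = true) :
    ∀ (n i : ℕ), OutFactsSB K S lo hi i n → OutFactsS K S i n := by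
  intro n
  induction n with
  | zero => intro i _; exact trivial
  | succ n ih => intro i hf; exact ⟨by rw [← canonNFZB_eq h (S i)]; exact hf.1, ih (i + 1) hf.2⟩

/-- `S`-facts give `…LocalB`'s two-list facts for the shares `S i, …` against EMPTY partials. -/
theorem facts₂Z_of_outFactsS (K : SymCertR) (S : ℕ → QPoly) :
    ∀ (n i : ℕ), OutFactsS K S i n → Facts₂Z K.toSymCert ((List.range' i n).map S) (List.replicate n []) := by
  intro n
  induction n with
  | zero => intro i _; exact trivial
  | succ n ih =>
    intro i h
    rw [List.range'_succ, List.map_cons, List.replicate_succ]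
    refine ⟨?_, ih (i + 1) h.2⟩
    rw [Bool.and_eq_true, psub_nil]
    exact ⟨rfl, h.1⟩

/-- **OUTROUTE with a substituted skeleton IS SOUND**: `S i ~ shareR K κ J i` for `i < J` + the `J` facts on `S`. -/
theorem wardD4CertGe_of_outrouteS (K : SymCertR) (hwf0 : wellFormed K.expand = true)
    (hRok : K.gramR.all (gramBlockROK K.frame) = true) (κ : Word → ℕ) (J : ℕ) (hJ : 0 < J) (S : ℕ → QPoly)
    (hS : ∀ i, i < J → (S i).Perm (shareR K κ J i)) (hfacts : OutFactsS K S 0 J) :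
    WardD4CertGe ((symValueR K : ℚ) : ℝ) := by
  have hwfb : wellFormed K.toSymCert = true := wellFormed_toSymCert_of_expand K hwf0
  have hmap : ∀ Λ' : Finset (Site 2), ((List.range J).map S).map (polyOp Λ') = (sharesR K κ J).map (polyOp Λ') := by
    intro Λ'
    rw [sharesR, List.map_map, List.map_map]
    refine List.map_congr_left fun i hi => ?_
    exact polyOp_perm Λ' (hS i (List.mem_range.mp hi))
  refine wardD4CertGe_of_facts₂ZR K hwf0 hRok ((List.range J).map S) (List.replicate J []) ?_
    (fun Λ' hFL => by rw [hmap Λ']; exact sum_sharesR K hwfb κ hJ hFL) ?_ ?_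
  · intro Q hQ
    rw [List.mem_map] at hQ
    obtain ⟨i, hi, rfl⟩ := hQ
    have hi' := List.mem_range.mp hi
    have hsh : PSupp (shareR K κ J i) K.frame.toFinset :=
      PSupp_sharesR K hwfb hRok κ J _ (by rw [sharesR, List.mem_map]; exact ⟨i, hi, rfl⟩)
    intro t ht
    exact hsh t ((hS i hi').mem_iff.mp ht)
  · rw [List.range_eq_range']
    exact facts₂Z_of_outFactsS K S J 0 hfacts
  · rw [List.flatten_replicate_nil]
    exact isZero_canonNFZV_nil K.frame

/-- Closing theorem for a substituted skeleton (box canon facts). -/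
theorem energyDensity_ge_of_outrouteSB (K : SymCertR) (hwf : wellFormed K.expand = true)
    (hRok : K.gramR.all (gramBlockROK K.frame) = true) (κ : Word → ℕ) (J : ℕ) (hJ : 0 < J) (S : ℕ → QPoly)
    (hS : ∀ i, i < J → (S i).Perm (shareR K κ J i)) (lo hi : ℤ × ℤ) (hbox : boxLicence K.frame lo hi = true)
    (hfacts : OutFactsSB K S lo hi 0 J) : ((symValueR K : ℚ) : ℝ) ≤ energyDensityTT' 1 0 8 (7 / 8) :=
  energyDensity_ge_of_windowSound_cert _ WardSlot.stub_wardWindowSound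
    (wardD4CertGe_of_outrouteS K hwf hRok κ J hJ S hS (outFactsS_of_B K S hbox J 0 hfacts))

/-! ##### (i) Toys: the bucketed form end to end (`J = 1` module, `L = 3` fine slots, box canon, `pairKey`), and the
substituted-skeleton theorem instantiated with `S := shareRF …` (a permutation of `shareR`, indeed equal). -/

example : ((symValueR toyRCert : ℚ) : ℝ) ≤ energyDensityTT' 1 0 8 (7 / 8) :=
  energyDensity_ge_of_outrouteBL toyRCert (by decide +kernel)
    (gramR_all_of_factsB toyRCert (minCornerP frame3) (maxCornerP frame3) (by decide +kernel) 2 (by decide +kernel)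
      ⟨by decide +kernel, by decide +kernel, trivial⟩)
    pairKey 1 3 Nat.one_pos (by norm_num) (minCornerP frame3) (maxCornerP frame3) (by decide +kernel)
    ⟨by decide +kernel, trivial⟩

example : ((symValueR toyRCert : ℚ) : ℝ) ≤ energyDensityTT' 1 0 8 (7 / 8) :=
  energyDensity_ge_of_outrouteSB toyRCert (by decide +kernel)
    (gramR_all_of_factsB toyRCert (minCornerP frame3) (maxCornerP frame3) (by decide +kernel) 2 (by decide +kernel)
      ⟨by decide +kernel, by decide +kernel, trivial⟩)
    netKey 3 (by norm_num) (shareRF toyRCert (toyRCert.gramR.map genBasis) netKey 3)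
    (fun i _ => by rw [shareRF_eq])
    (minCornerP frame3) (maxCornerP frame3) (by decide +kernel)
    ⟨by decide +kernel, by decide +kernel, by decide +kernel, trivial⟩

end Summit.Ventures.CertifiedManyBodySolver.Theorems.SymReplay

end
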